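import Summits.QuantumAdvantage.QuantumAdvantage.Theorems.SosSandwichPseudoBoundedAAClassicalCornerL2OSSSNoGoPrep
import Summits.QuantumAdvantage.QuantumAdvantage.Theorems.SosSandwichPseudoBoundedAAClassicalCornerBlockProduct
import HarnessLib

/-!
# Crux `PseudoBoundedAA` (stmt-QuantumAdvantage-15237, route SosSandwich) — the `L²`-OSSS question on the classical
# corner: NO-GO for the UN-normalised per-tree route with a BALANCED tree, part 1/2 — the gluing step

Support file (`--supports stmt-QuantumAdvantage-15237`), sequel of `…ClassicalCornerL2OSSSNoGo.lean` (which closed the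
VARIANCE-normalised per-tree route with the caterpillar, an unbalanced tree).  The stronger statement (part 2,
`…ClassicalCornerL2OSSSNoGoBalanced.lean`): there is NO constant `A'` with

  `Cov[F, g]² ≤ A' · Σⱼ δⱼ(t) · Infⱼ[g]`   for all decision trees `t` (output `F`) and all real `g`,

not even for BALANCED trees (`Var F = ¼`); it would have given the census's `L²`-OSSS law with `C₀ = 16A'` by
Cauchy–Schwarz over the mixture.  Witness: the RECURSIVE BINARY ADDRESS TREE (`T_1` = dictator; `T_{k+1}` = query a fresh
address bit, then a fresh copy of `T_k` on the selected one of two disjoint blocks), `g :=` the sum over ALL subtrees of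
their outputs: `Cov[F,g] = depth/4` while `Σⱼ δⱼ Infⱼ[g] ≤ 3·depth`.

This part proves the GLUING STEP on a fixed cube `{0,1}^N` (blocks are finsets of coordinates; no re-indexing): from two
pairs `(t⁰, g⁰)`, `(t¹, g¹)` supported on disjoint blocks `B₀, B₁ ∌ a`, with `0/1` outputs `F⁰, F¹` of mean `½`, the glued
pair `t' = query a t⁰ t¹`, `g' = g⁰ + g¹ + F'` satisfies, in un-normalised cube sums (`Wⱼ = #{x : j ∈ t.queries x}`,
`Sⱼ = Σₓ(Δⱼg)²`, `Pⱼ = Σₓ Δⱼg·ΔⱼF`, `Iⱼ = Σₓ(ΔⱼF)²`, `Δⱼφ(x) = φ(x^{j→1}) − φ(x^{j→0})`):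
`Σ F' = 2^N/2`, `Cov' = (Cov⁰ + Cov¹)/2 + 4^N/4`, `ΣWI' = 4^N/2 + (ΣWI⁰ + ΣWI¹)/4`,
`ΣWP' = 4^N/2 + (ΣWP⁰ + ΣWI⁰ + ΣWP¹ + ΣWI¹)/4`, `ΣWS' = 4^N/2 + (ΣWS⁰ + ΣWP⁰ + ΣWI⁰/2 + ΣWS¹ + ΣWP¹ + ΣWI¹/2)/2`
(`glue_invariants`), together with the support bookkeeping (`glue_queries_subset`, `glue_dep`).

Honest label: calibration (no-go for a proof strategy) in the classical corner of an open conjecture; nothing is closed.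
Sources: O'Donnell–Saks–Schramm–Servedio, FOCS 2005, Thm 3.2; R. O'Donnell, *Analysis of Boolean Functions* (2014) §8.6.
-/

set_option linter.dupNamespace false

noncomputable section

namespace Summit.QuantumAdvantage.QuantumAdvantage.Theorems.SosSandwich

open Finset Function
open Literature.Computability.Complexity

namespace ClassicalCornerL2OSSSNoGoBalanced

variable {N : ℕ}

/-! ### Support bookkeeping -/

/-- A function depending only on the block `B` ignores updates outside `B`. [folklore] -/
theorem apply_update_of_dep {B : Finset (Fin N)} {g : (Fin N → Bool) → ℝ}
    (hg : ∀ x y : Fin N → Bool, (∀ i ∈ B, x i = y i) → g x = g y) {a : Fin N} (ha : a ∉ B)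
    (x : Fin N → Bool) (c : Bool) : g (update x a c) = g x :=
  hg _ _ fun _ hi => update_of_ne (ne_of_mem_of_not_mem hi ha) c x

/-- A function depending only on `B` has no increment across a coordinate outside `B`. [folklore] -/
theorem increment_eq_zero_of_dep {B : Finset (Fin N)} {g : (Fin N → Bool) → ℝ}
    (hg : ∀ x y : Fin N → Bool, (∀ i ∈ B, x i = y i) → g x = g y) {j : Fin N} (hj : j ∉ B)
    (x : Fin N → Bool) : g (update x j true) - g (update x j false) = 0 := by
  rw [sub_eq_zero]
  exact hg _ _ fun i hi => by
    rw [update_of_ne (ne_of_mem_of_not_mem hi hj), update_of_ne (ne_of_mem_of_not_mem hi hj)]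

/-- A tree querying only coordinates of `B` follows the same path on inputs agreeing on `B`. [folklore] -/
theorem eval_queries_eq_of_agree {B : Finset (Fin N)} {t : DecisionTree N}
    (hq : ∀ x j, j ∈ t.queries x → j ∈ B) {x y : Fin N → Bool} (h : ∀ i ∈ B, x i = y i) :
    t.eval y = t.eval x ∧ t.queries y = t.queries x := by
  have := DecisionTree.queries_eq_of_agree t (x := x) (y := y) fun i hi => (h i (hq x i hi)).symm
  exact ⟨this.2.1, this.1⟩

/-- The `0/1` output of a tree supported on `B` depends only on `B`. [folklore] -/
theorem dep_of_queries_subset {B : Finset (Fin N)} {t : DecisionTree N}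
    (hq : ∀ x j, j ∈ t.queries x → j ∈ B) (F : (Fin N → Bool) → ℝ)
    (hF : ∀ x, F x = if t.eval x = true then (1 : ℝ) else 0) :
    ∀ x y : Fin N → Bool, (∀ i ∈ B, x i = y i) → F x = F y := by
  intro x y h
  rw [hF, hF, (eval_queries_eq_of_agree hq h).1]

/-- The glued tree queries only `a` and the coordinates of the two blocks. [folklore] -/
theorem glue_queries_subset {B B₀ B₁ : Finset (Fin N)} {a : Fin N} {t₀ t₁ : DecisionTree N}
    (h₀ : ∀ x j, j ∈ t₀.queries x → j ∈ B₀) (h₁ : ∀ x j, j ∈ t₁.queries x → j ∈ B₁)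
    (hB₀ : B₀ ⊆ B) (hB₁ : B₁ ⊆ B) (ha : a ∈ B) :
    ∀ x j, j ∈ (DecisionTree.query a t₀ t₁).queries x → j ∈ B := by
  intro x j hj
  rw [DecisionTree.queries_query, Finset.mem_insert] at hj
  rcases hj with rfl | hj
  · exact ha
  · by_cases hxa : x a = true
    · rw [if_pos hxa] at hj; exact hB₁ (h₁ x j hj)
    · rw [if_neg hxa] at hj; exact hB₀ (h₀ x j hj)

/-- The glued function `g' = g⁰ + g¹ + F'` depends only on `B ⊇ B₀ ∪ B₁ ∪ {a}`. [folklore] -/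
theorem glue_dep {B B₀ B₁ : Finset (Fin N)} {a : Fin N} {t₀ t₁ : DecisionTree N}
    {g₀ g₁ g' F' : (Fin N → Bool) → ℝ}
    (h₀ : ∀ x j, j ∈ t₀.queries x → j ∈ B₀) (h₁ : ∀ x j, j ∈ t₁.queries x → j ∈ B₁)
    (hg₀ : ∀ x y : Fin N → Bool, (∀ i ∈ B₀, x i = y i) → g₀ x = g₀ y)
    (hg₁ : ∀ x y : Fin N → Bool, (∀ i ∈ B₁, x i = y i) → g₁ x = g₁ y)
    (hB₀ : B₀ ⊆ B) (hB₁ : B₁ ⊆ B) (ha : a ∈ B)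
    (hF' : ∀ x, F' x = if (DecisionTree.query a t₀ t₁).eval x = true then (1 : ℝ) else 0)
    (hg' : ∀ x, g' x = g₀ x + g₁ x + F' x) :
    ∀ x y : Fin N → Bool, (∀ i ∈ B, x i = y i) → g' x = g' y := by
  intro x y h
  rw [hg', hg', hg₀ x y fun i hi => h i (hB₀ hi), hg₁ x y fun i hi => h i (hB₁ hi),
    dep_of_queries_subset (glue_queries_subset h₀ h₁ hB₀ hB₁ ha) F' hF' x y h]

/-- Increments of a function supported on `B` are again supported on `B`. [folklore] -/
theorem dep_increment {B : Finset (Fin N)} {g : (Fin N → Bool) → ℝ}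
    (hg : ∀ x y : Fin N → Bool, (∀ i ∈ B, x i = y i) → g x = g y) (j : Fin N) :
    ∀ x y : Fin N → Bool, (∀ i ∈ B, x i = y i) →
      g (update x j true) - g (update x j false) = g (update y j true) - g (update y j false) := by
  intro x y h
  have hu : ∀ c, ∀ i ∈ B, update x j c i = update y j c i := by
    intro c i hi
    by_cases hij : i = j
    · subst hij; simp
    · rw [update_of_ne hij, update_of_ne hij, h i hi]
  rw [hg _ _ (hu true), hg _ _ (hu false)]

/-- `x a ≠ c` forces `x a = !c`. [folklore] -/
theorem eq_not_of_ne {b c : Bool} (h : ¬ b = c) : b = !c := by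
  cases b <;> cases c <;> simp at h ⊢

/-- Halving along a free coordinate, with a prescribed value `c`: `Σₓ [x a = c]·ψ(x) = ½ Σₓ ψ(x)` if `ψ` ignores
`x a`. [folklore] -/
theorem sum_ite_eq_half (a : Fin N) (c : Bool) (ψ : (Fin N → Bool) → ℝ) (hψ : ∀ x b, ψ (update x a b) = ψ x) :
    ∑ x, (if x a = c then ψ x else 0) = (∑ x, ψ x) / 2 := by
  have ht := ClassicalCornerL2OSSSNoGo.sum_ite_apply_eq_half a ψ hψ
  cases c
  · have hsplit : ∑ x : Fin N → Bool, (if x a = false then ψ x else 0) =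
        ∑ x, ψ x - ∑ x, (if x a = true then ψ x else 0) := by
      rw [← Finset.sum_sub_distrib]
      refine Finset.sum_congr rfl fun x _ => ?_
      rcases Bool.eq_false_or_eq_true (x a) with h | h <;> simp [h]
    rw [hsplit, ht]; ring
  · exact ht

/-! ### The gluing step, for Bool-indexed block data

Data: blocks `Bl c`, trees `t c`, their `0/1` outputs `F c` and companion functions `g c` (`c : Bool`), a fresh address
bit `a`; the glued tree is `query a (t false) (t true)` with output `F'` and companion `g' = g false + g true + F'`. -/

section Glue

variable {Bl : Bool → Finset (Fin N)} {a : Fin N} {t : Bool → DecisionTree N}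
  {g F : Bool → (Fin N → Bool) → ℝ} {g' F' : (Fin N → Bool) → ℝ}

/-- `F'(x) = F_{x a}(x)`. [folklore] -/
theorem glue_F_apply (hF : ∀ c x, F c x = if (t c).eval x = true then (1 : ℝ) else 0)
    (hF' : ∀ x, F' x = if (DecisionTree.query a (t false) (t true)).eval x = true then (1 : ℝ) else 0)
    (x : Fin N → Bool) : F' x = F (x a) x := by
  rw [hF', DecisionTree.eval_query]
  rcases Bool.eq_false_or_eq_true (x a) with h | h
  · simp only [h, if_true]; exact (hF true x).symm
  · simp only [h, Bool.false_eq_true, if_false]; exact (hF false x).symm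

/-- **One block coordinate.** For `j ∉ Bl (!c)`, `j ≠ a` (blocks disjoint from each other and from `a`, trees and
companions supported on their blocks): the query weight of `j` in the glued tree is half that in `t c`, and
`Σ(ΔⱼF')² = Iⱼ/2`, `Σ Δⱼg'·ΔⱼF' = (Pⱼ + Iⱼ)/2`, `Σ(Δⱼg')² = Sⱼ + Pⱼ + Iⱼ/2` with `S, P, I` the block-`c` sums. [folklore] -/
theorem glue_sums_block (ha : ∀ c, a ∉ Bl c)
    (hq : ∀ c x j, j ∈ (t c).queries x → j ∈ Bl c)
    (hF : ∀ c x, F c x = if (t c).eval x = true then (1 : ℝ) else 0)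
    (hg : ∀ c (x y : Fin N → Bool), (∀ i ∈ Bl c, x i = y i) → g c x = g c y)
    (hF' : ∀ x, F' x = if (DecisionTree.query a (t false) (t true)).eval x = true then (1 : ℝ) else 0)
    (hg' : ∀ x, g' x = g false x + g true x + F' x)
    (c : Bool) {j : Fin N} (hj : j ∉ Bl (!c)) (hja : j ≠ a) :
    ((Finset.univ.filter fun x : Fin N → Bool => j ∈ (DecisionTree.query a (t false) (t true)).queries x).card : ℝ) =
      ((Finset.univ.filter fun x : Fin N → Bool => j ∈ (t c).queries x).card : ℝ) / 2 ∧
    ∑ x, (F' (update x j true) - F' (update x j false)) ^ 2 =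
      (∑ x, (F c (update x j true) - F c (update x j false)) ^ 2) / 2 ∧
    ∑ x, (g' (update x j true) - g' (update x j false)) * (F' (update x j true) - F' (update x j false)) =
      ((∑ x, (g c (update x j true) - g c (update x j false)) * (F c (update x j true) - F c (update x j false))) +
        ∑ x, (F c (update x j true) - F c (update x j false)) ^ 2) / 2 ∧
    ∑ x, (g' (update x j true) - g' (update x j false)) ^ 2 =
      (∑ x, (g c (update x j true) - g c (update x j false)) ^ 2) +
      (∑ x, (g c (update x j true) - g c (update x j false)) * (F c (update x j true) - F c (update x j false))) +
      (∑ x, (F c (update x j true) - F c (update x j false)) ^ 2) / 2 := by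
  classical
  have hdF : ∀ c, ∀ x y : Fin N → Bool, (∀ i ∈ Bl c, x i = y i) → F c x = F c y :=
    fun c => dep_of_queries_subset (hq c) (F c) (hF c)
  -- abbreviations for the block-`c` increments (supported on `Bl c ∌ a`)
  obtain ⟨dg, hdg⟩ : ∃ dg : (Fin N → Bool) → ℝ, ∀ x, dg x = g c (update x j true) - g c (update x j false) :=
    ⟨_, fun _ => rfl⟩
  obtain ⟨dF, hdFd⟩ : ∃ dF : (Fin N → Bool) → ℝ, ∀ x, dF x = F c (update x j true) - F c (update x j false) :=
    ⟨_, fun _ => rfl⟩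
  simp only [← hdg, ← hdFd]
  have hdg_dep : ∀ x y : Fin N → Bool, (∀ i ∈ Bl c, x i = y i) → dg x = dg y :=
    fun x y h => by rw [hdg, hdg]; exact dep_increment (hg c) j x y h
  have hdF_dep : ∀ x y : Fin N → Bool, (∀ i ∈ Bl c, x i = y i) → dF x = dF y :=
    fun x y h => by rw [hdFd, hdFd]; exact dep_increment (hdF c) j x y h
  have hdg_upd : ∀ x b, dg (update x a b) = dg x := apply_update_of_dep hdg_dep (ha c)
  have hdF_upd : ∀ x b, dF (update x a b) = dF x := apply_update_of_dep hdF_dep (ha c)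
  -- the other block's increments vanish
  have hg0 : ∀ x, g (!c) (update x j true) - g (!c) (update x j false) = 0 := increment_eq_zero_of_dep (hg (!c)) hj
  have hF0 : ∀ x, F (!c) (update x j true) - F (!c) (update x j false) = 0 :=
    increment_eq_zero_of_dep (hdF (!c)) hj
  -- pointwise shapes
  have hΔF : ∀ x, F' (update x j true) - F' (update x j false) = if x a = c then dF x else 0 := by
    intro x
    rw [glue_F_apply hF hF' (update x j true), glue_F_apply hF hF' (update x j false),
      update_of_ne hja.symm, update_of_ne hja.symm]
    by_cases hxa : x a = c
    · rw [if_pos hxa, hxa, hdFd]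
    · rw [if_neg hxa, eq_not_of_ne hxa]
      exact hF0 x
  have hgsum : ∀ x, (g false (update x j true) - g false (update x j false)) +
      (g true (update x j true) - g true (update x j false)) = dg x := by
    intro x
    have h0 := hg0 x
    rw [hdg]
    cases c
    · simp only [Bool.not_false] at h0; linarith
    · simp only [Bool.not_true] at h0; linarith
  have hΔg : ∀ x, g' (update x j true) - g' (update x j false) = dg x + (if x a = c then dF x else 0) := by
    intro x
    rw [hg', hg', ← hΔF x, ← hgsum x]
    ring
  refine ⟨?_, ?_, ?_, ?_⟩
  · -- query weight
    rw [Finset.card_filter, Finset.card_filter]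
    push_cast
    have hind : ∀ x : Fin N → Bool,
        (if j ∈ (DecisionTree.query a (t false) (t true)).queries x then (1 : ℝ) else 0) =
        if x a = c then (if j ∈ (t c).queries x then (1 : ℝ) else 0) else 0 := by
      intro x
      have hbr : (if x a = true then (t true).queries x else (t false).queries x) = (t (x a)).queries x := by
        rcases Bool.eq_false_or_eq_true (x a) with h | h <;> simp [h]
      by_cases hxa : x a = c
      · have hiff : j ∈ (DecisionTree.query a (t false) (t true)).queries x ↔ j ∈ (t c).queries x := by
          rw [DecisionTree.queries_query, Finset.mem_insert, hbr, hxa]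
          exact ⟨fun h => h.resolve_left hja, fun h => Or.inr h⟩
        rw [if_pos hxa]
        by_cases hm : j ∈ (t c).queries x
        · rw [if_pos hm, if_pos (hiff.mpr hm)]
        · rw [if_neg hm, if_neg (fun h => hm (hiff.mp h))]
      · have hxa' : x a = !c := eq_not_of_ne hxa
        have hn : j ∉ (DecisionTree.query a (t false) (t true)).queries x := by
          rw [DecisionTree.queries_query, Finset.mem_insert, not_or, hbr, hxa']
          exact ⟨hja, fun h => hj (hq (!c) x j h)⟩
        rw [if_neg hn, if_neg hxa]
    rw [Finset.sum_congr rfl fun x _ => hind x]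
    have hupdq : ∀ x b, (if j ∈ (t c).queries (update x a b) then (1 : ℝ) else 0) =
        if j ∈ (t c).queries x then (1 : ℝ) else 0 := by
      intro x b
      rw [(eval_queries_eq_of_agree (hq c) (x := x) (y := update x a b)
        fun i hi => (update_of_ne (ne_of_mem_of_not_mem hi (ha c)) b x).symm).2]
    rw [sum_ite_eq_half a c _ hupdq]
  · -- `Σ (ΔF')²`
    have hre : ∀ x, (F' (update x j true) - F' (update x j false)) ^ 2 =
        if x a = c then dF x ^ 2 else 0 := by
      intro x; rw [hΔF x]; split_ifs <;> ring
    rw [Finset.sum_congr rfl fun x _ => hre x, sum_ite_eq_half a c _ (fun x b => by rw [hdF_upd])]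
  · -- `Σ Δg'·ΔF'`
    have hre : ∀ x, (g' (update x j true) - g' (update x j false)) * (F' (update x j true) - F' (update x j false)) =
        if x a = c then (dg x * dF x + dF x ^ 2) else 0 := by
      intro x; rw [hΔg x, hΔF x]; split_ifs <;> ring
    rw [Finset.sum_congr rfl fun x _ => hre x, sum_ite_eq_half a c _ (fun x b => by rw [hdF_upd, hdg_upd]),
      Finset.sum_add_distrib]
  · -- `Σ (Δg')²`
    have hre : ∀ x, (g' (update x j true) - g' (update x j false)) ^ 2 =
        dg x ^ 2 + (if x a = c then (2 * (dg x * dF x) + dF x ^ 2) else 0) := by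
      intro x; rw [hΔg x]; split_ifs <;> ring
    rw [Finset.sum_congr rfl fun x _ => hre x, Finset.sum_add_distrib,
      sum_ite_eq_half a c _ (fun x b => by rw [hdF_upd, hdg_upd]), Finset.sum_add_distrib, ← Finset.mul_sum]
    ring

/-- **The address coordinate.** `a` is always queried; `Δₐg' = ΔₐF' = F_true − F_false`, and if both outputs have
mean `½` (and live on disjoint blocks) then `Σₓ (F_true − F_false)² = 2^N/2`. [folklore] -/
theorem glue_sums_addr (hdis : Disjoint (Bl false) (Bl true)) (ha : ∀ c, a ∉ Bl c)
    (hq : ∀ c x j, j ∈ (t c).queries x → j ∈ Bl c)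
    (hF : ∀ c x, F c x = if (t c).eval x = true then (1 : ℝ) else 0)
    (hg : ∀ c (x y : Fin N → Bool), (∀ i ∈ Bl c, x i = y i) → g c x = g c y)
    (hF' : ∀ x, F' x = if (DecisionTree.query a (t false) (t true)).eval x = true then (1 : ℝ) else 0)
    (hg' : ∀ x, g' x = g false x + g true x + F' x)
    (hmean : ∀ c, ∑ x, F c x = (2 : ℝ) ^ N / 2) :
    ((Finset.univ.filter fun x : Fin N → Bool => a ∈ (DecisionTree.query a (t false) (t true)).queries x).card : ℝ)
      = (2 : ℝ) ^ N ∧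
    ∑ x, (F' (update x a true) - F' (update x a false)) ^ 2 = (2 : ℝ) ^ N / 2 ∧
    ∑ x, (g' (update x a true) - g' (update x a false)) * (F' (update x a true) - F' (update x a false)) =
      (2 : ℝ) ^ N / 2 ∧
    ∑ x, (g' (update x a true) - g' (update x a false)) ^ 2 = (2 : ℝ) ^ N / 2 := by
  classical
  have hdF : ∀ c, ∀ x y : Fin N → Bool, (∀ i ∈ Bl c, x i = y i) → F c x = F c y :=
    fun c => dep_of_queries_subset (hq c) (F c) (hF c)
  have hFupd : ∀ c x b, F c (update x a b) = F c x := fun c => apply_update_of_dep (hdF c) (ha c)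
  have hgupd : ∀ c x b, g c (update x a b) = g c x := fun c => apply_update_of_dep (hg c) (ha c)
  have hΔF : ∀ x, F' (update x a true) - F' (update x a false) = F true x - F false x := by
    intro x
    rw [glue_F_apply hF hF' (update x a true), glue_F_apply hF hF' (update x a false)]
    simp only [update_self]
    rw [hFupd, hFupd]
  have hΔg : ∀ x, g' (update x a true) - g' (update x a false) = F true x - F false x := by
    intro x
    rw [hg', hg', ← hΔF x]
    simp only [hgupd]
    ring
  -- `Σ (F₁ − F₀)² = Σ F₁ + Σ F₀ − 2 Σ F₀F₁ = 2^N − 2·(2^N/2)(2^N/2)/2^N = 2^N/2`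
  have hsq : ∀ c x, F c x ^ 2 = F c x := by
    intro c x; rw [hF c x]; split_ifs <;> norm_num
  have hind : (2 : ℝ) ^ N * ∑ x, F false x * F true x = (∑ x, F false x) * (∑ x, F true x) :=
    ClassicalCornerBlockProduct.two_pow_mul_sum_mul_eq_sum_mul_sum (Bl false) (F false) (F true) (hdF false)
      (fun x y h => hdF true x y fun i hi => h i (Finset.disjoint_right.mp hdis hi))
  have h2N : (0 : ℝ) < (2 : ℝ) ^ N := by positivity
  have hkey : ∑ x, (F true x - F false x) ^ 2 = (2 : ℝ) ^ N / 2 := by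
    have hexp : ∀ x, (F true x - F false x) ^ 2 = F true x + F false x - 2 * (F false x * F true x) := by
      intro x
      have h1 := hsq true x; have h0 := hsq false x
      nlinarith
    rw [Finset.sum_congr rfl fun x _ => hexp x, Finset.sum_sub_distrib, Finset.sum_add_distrib, ← Finset.mul_sum,
      hmean, hmean]
    have hprod : ∑ x, F false x * F true x = (2 : ℝ) ^ N / 4 := by
      have := hind
      rw [hmean, hmean] at this
      field_simp at this ⊢
      nlinarith [this]
    rw [hprod]; ring
  refine ⟨?_, ?_, ?_, ?_⟩
  · have hall : (Finset.univ.filter fun x : Fin N → Bool =>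
        a ∈ (DecisionTree.query a (t false) (t true)).queries x) = Finset.univ := by
      refine Finset.filter_true_of_mem fun x _ => ?_
      rw [DecisionTree.queries_query]
      exact Finset.mem_insert_self _ _
    rw [hall, Finset.card_univ, BooleanCorner.card_cube_nat]
    push_cast; ring
  · rw [Finset.sum_congr rfl fun x _ => by rw [hΔF x], hkey]
  · rw [Finset.sum_congr rfl fun x _ => by rw [hΔF x, hΔg x, ← sq], hkey]
  · rw [Finset.sum_congr rfl fun x _ => by rw [hΔg x], hkey]

/-- **Mean and covariance of the glued pair.** `Σ F' = 2^N/2` and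
`2^N Σ F'g' − Σ F' Σ g' = ½·Σ_c (2^N Σ F_c g_c − Σ F_c Σ g_c) + 4^N/4`. [folklore] -/
theorem glue_cov (hdis : Disjoint (Bl false) (Bl true)) (ha : ∀ c, a ∉ Bl c)
    (hq : ∀ c x j, j ∈ (t c).queries x → j ∈ Bl c)
    (hF : ∀ c x, F c x = if (t c).eval x = true then (1 : ℝ) else 0)
    (hg : ∀ c (x y : Fin N → Bool), (∀ i ∈ Bl c, x i = y i) → g c x = g c y)
    (hF' : ∀ x, F' x = if (DecisionTree.query a (t false) (t true)).eval x = true then (1 : ℝ) else 0)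
    (hg' : ∀ x, g' x = g false x + g true x + F' x)
    (hmean : ∀ c, ∑ x, F c x = (2 : ℝ) ^ N / 2) :
    ∑ x, F' x = (2 : ℝ) ^ N / 2 ∧
    (2 : ℝ) ^ N * (∑ x, F' x * g' x) - (∑ x, F' x) * (∑ x, g' x) =
      (((2 : ℝ) ^ N * (∑ x, F false x * g false x) - (∑ x, F false x) * (∑ x, g false x)) +
        ((2 : ℝ) ^ N * (∑ x, F true x * g true x) - (∑ x, F true x) * (∑ x, g true x))) / 2 +
      (4 : ℝ) ^ N / 4 := by
  have hdF : ∀ c, ∀ x y : Fin N → Bool, (∀ i ∈ Bl c, x i = y i) → F c x = F c y :=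
    fun c => dep_of_queries_subset (hq c) (F c) (hF c)
  have hFupd : ∀ c x b, F c (update x a b) = F c x := fun c => apply_update_of_dep (hdF c) (ha c)
  have hgupd : ∀ c x b, g c (update x a b) = g c x := fun c => apply_update_of_dep (hg c) (ha c)
  have hF'ite : ∀ x, F' x = if x a = true then F true x else F false x := by
    intro x
    rw [glue_F_apply hF hF' x]
    rcases Bool.eq_false_or_eq_true (x a) with h | h <;> simp [h]
  -- `Σ F'`
  have hsumF' : ∑ x, F' x = (2 : ℝ) ^ N / 2 := by
    rw [Finset.sum_congr rfl fun x _ => hF'ite x,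
      BooleanCorner.sum_ite_update a _ _ (hFupd true) (hFupd false), hmean, hmean]
    ring
  have hsq : ∀ x, F' x * F' x = F' x := by
    intro x; rw [hF' x]; split_ifs <;> norm_num
  -- independence across blocks: `2^N Σ F_c · g_{!c} = Σ F_c Σ g_{!c}`
  have hdj : ∀ c, ∀ i ∈ Bl (!c), i ∉ Bl c := by
    intro c i hi
    cases c
    · exact fun h => Finset.disjoint_left.mp hdis h hi
    · exact fun h => Finset.disjoint_left.mp hdis hi h
  have hind : ∀ c, (2 : ℝ) ^ N * ∑ x, F c x * g (!c) x = (∑ x, F c x) * (∑ x, g (!c) x) := by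
    intro c
    exact ClassicalCornerBlockProduct.two_pow_mul_sum_mul_eq_sum_mul_sum (Bl c) (F c) (g (!c)) (hdF c)
      (fun x y h => hg (!c) x y fun i hi => h i (hdj c i hi))
  -- `Σ F' g_c = (Σ F_c g_c + Σ F_{!c} g_c)/2`
  have hFg : ∀ c, ∑ x, F' x * g c x = ((∑ x, F true x * g c x) + ∑ x, F false x * g c x) / 2 := by
    intro c
    have hre : ∀ x, F' x * g c x = if x a = true then F true x * g c x else F false x * g c x := by
      intro x; rw [hF'ite x]; split_ifs <;> rfl
    rw [Finset.sum_congr rfl fun x _ => hre x,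
      BooleanCorner.sum_ite_update a _ _ (fun x b => by rw [hFupd, hgupd]) (fun x b => by rw [hFupd, hgupd])]
  have h2N : (0 : ℝ) < (2 : ℝ) ^ N := by positivity
  have hcross : ∀ c, ∑ x, F (!c) x * g c x = (∑ x, g c x) / 2 := by
    intro c
    have h := hind (!c)
    rw [Bool.not_not, hmean] at h
    field_simp at h
    field_simp
    linarith
  refine ⟨hsumF', ?_⟩
  have htot : ∑ x, F' x * g' x = ∑ x, F' x * g false x + ∑ x, F' x * g true x + ∑ x, F' x := by
    rw [← Finset.sum_add_distrib, ← Finset.sum_add_distrib]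
    refine Finset.sum_congr rfl fun x _ => ?_
    rw [hg' x, mul_add, mul_add, hsq]
  have hg'sum : ∑ x, g' x = ∑ x, g false x + ∑ x, g true x + (2 : ℝ) ^ N / 2 := by
    rw [← hsumF', ← Finset.sum_add_distrib, ← Finset.sum_add_distrib]
    exact Finset.sum_congr rfl fun x _ => hg' x
  rw [htot, hFg, hFg, hg'sum, hsumF', hmean, hmean]
  have h0 := hcross false
  have h1 := hcross true
  simp only [Bool.not_false, Bool.not_true] at h0 h1
  rw [h0, h1, show (4 : ℝ) ^ N = (2 : ℝ) ^ N * (2 : ℝ) ^ N by rw [← mul_pow]; norm_num]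
  ring

end Glue

end ClassicalCornerL2OSSSNoGoBalanced

end Summit.QuantumAdvantage.QuantumAdvantage.Theorems.SosSandwich
end
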